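import Literature.Algebra.Polynomial.FischerInnerProduct
import HarnessLib

/-!
# Number operators in Fischer–Fock space and the mixed-energy inequality

For real polynomials in the variables `ι` with the Fischer inner product `⟨p, q⟩_F = Σ α! p_α q_α`
(`FischerInnerProduct`), the *number operator along `i`*, `Nᵢ = xᵢ ∂ᵢ`, is diagonal:
`(xᵢ ∂ᵢ q)_α = αᵢ q_α`, and `xᵢ² ∂ᵢ² = Nᵢ (Nᵢ - 1)`. By adjointness this gives the coefficient
formulas

* `fischerInner_pderiv_self_eq_sum` : `‖∂ᵢ r‖²_F = Σ_α αᵢ · α! r_α²`,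
* `fischerInner_pderiv_pderiv_self_eq_sum` : `‖∂ᵢ² r‖²_F = Σ_α αᵢ (αᵢ - 1) · α! r_α²`,

and, for `r` homogeneous of degree `n`, the **mixed-energy inequality**
(`four_mul_sub_le_sq_mul_mixedSum`)

`4 ((n - 1) ‖∂ᵢ r‖² - ‖∂ᵢ² r‖²) = 4 Σ_α αᵢ (n - αᵢ) α! r_α² ≤ n² Σ_{α : 1 ≤ αᵢ, α ≠ αᵢ eᵢ} α! r_α²`

(termwise `4 a (n - a) ≤ n²`, and `a (n - a) = 0` unless `1 ≤ a ≤ n - 1`). The right-hand sum is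
the Fischer energy of the modes of `r` that depend on `xᵢ` *and* on some other variable (the
`mixedEnergy` of `Literature.Probability.Distributions.GaussianRectangleForm`); the inequality is
the spectral estimate `1_{[1, n-1]}(Nᵢ) ≥ (4/n²) Nᵢ (n - Nᵢ)` on degree-`n` polynomials used in the
spectral-gap proof for the linearised Boltzmann operator.
-/

open MvPolynomial Finset
open scoped Nat

namespace Literature.Algebra.Polynomial

noncomputable section

variable {ι : Type*} [Fintype ι] [DecidableEq ι]

/-! ### Coefficients of `xᵢ ∂ᵢ q` and `xᵢ² ∂ᵢ² q` -/

omit [Fintype ι] in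
/-- `(xᵢ ∂ᵢ q)_α = αᵢ q_α`: the number operator along `i` is diagonal on monomials. [folklore] -/
theorem coeff_X_mul_pderiv (i : ι) (q : MvPolynomial ι ℝ) (α : ι →₀ ℕ) :
    coeff α (X i * pderiv i q) = (α i : ℝ) * coeff α q := by
  rw [coeff_X_mul']
  by_cases h : i ∈ α.support
  · rw [if_pos h, coeff_pderiv]
    have hi : α i ≠ 0 := Finsupp.mem_support_iff.1 h
    rw [Finsupp.sub_add_single_one_cancel hi, Finsupp.tsub_apply, Finsupp.single_eq_same]
    have : 1 ≤ α i := Nat.one_le_iff_ne_zero.2 hi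
    push_cast [Nat.cast_sub this]
    ring
  · rw [if_neg h]
    have hi : α i = 0 := by simpa [Finsupp.mem_support_iff] using h
    rw [hi, Nat.cast_zero, zero_mul]

omit [Fintype ι] in
/-- `(xᵢ² ∂ᵢ² q)_α = αᵢ (αᵢ - 1) q_α`. [folklore] -/
theorem coeff_X_mul_X_mul_pderiv_pderiv (i : ι) (q : MvPolynomial ι ℝ) (α : ι →₀ ℕ) :
    coeff α (X i * (X i * pderiv i (pderiv i q))) = (α i : ℝ) * ((α i : ℝ) - 1) * coeff α q := by
  rw [coeff_X_mul']
  by_cases h : i ∈ α.support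
  · rw [if_pos h, coeff_X_mul_pderiv, coeff_pderiv]
    have hi : α i ≠ 0 := Finsupp.mem_support_iff.1 h
    rw [Finsupp.sub_add_single_one_cancel hi, Finsupp.tsub_apply, Finsupp.single_eq_same]
    have : 1 ≤ α i := Nat.one_le_iff_ne_zero.2 hi
    push_cast [Nat.cast_sub this]
    ring
  · rw [if_neg h]
    have hi : α i = 0 := by simpa [Finsupp.mem_support_iff] using h
    rw [hi, Nat.cast_zero, zero_mul, zero_mul]

/-! ### Diagonal operators and the two norm identities -/

/-- **Expectation of a diagonal operator**: if `(D q)_α = d(α) q_α` for all `α`, then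
`⟨q, D q⟩_F = Σ_{α ∈ supp q} d(α) α! q_α²`. [folklore] -/
theorem fischerInner_diagonal {q Dq : MvPolynomial ι ℝ} {d : (ι →₀ ℕ) → ℝ}
    (h : ∀ α, coeff α Dq = d α * coeff α q) :
    fischerInner q Dq = ∑ α ∈ q.support, d α * (mfactorial α * coeff α q ^ 2) := by
  have hsupp : Dq.support ⊆ q.support := fun α hα => by
    rw [mem_support_iff] at hα ⊢
    intro h0
    exact hα (by rw [h α, h0, mul_zero])
  rw [fischerInner_eq_sum_of_subset (s := q.support) (Finset.union_subset subset_rfl hsupp)]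
  refine Finset.sum_congr rfl fun α _ => ?_
  rw [h α]
  ring

/-- **`‖∂ᵢ r‖²_F = Σ_α αᵢ α! r_α²`** (`‖∂ᵢ r‖² = ⟨r, xᵢ ∂ᵢ r⟩ = ⟨r, Nᵢ r⟩`). [folklore] -/
theorem fischerInner_pderiv_self_eq_sum (i : ι) (r : MvPolynomial ι ℝ) :
    fischerInner (pderiv i r) (pderiv i r) =
      ∑ α ∈ r.support, (α i : ℝ) * (mfactorial α * coeff α r ^ 2) := by
  rw [fischerInner_pderiv_left]
  exact fischerInner_diagonal (coeff_X_mul_pderiv i r)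

/-- **`‖∂ᵢ² r‖²_F = Σ_α αᵢ (αᵢ - 1) α! r_α²`** (`‖∂ᵢ² r‖² = ⟨r, xᵢ² ∂ᵢ² r⟩ = ⟨r, Nᵢ(Nᵢ - 1) r⟩`). [folklore] -/
theorem fischerInner_pderiv_pderiv_self_eq_sum (i : ι) (r : MvPolynomial ι ℝ) :
    fischerInner (pderiv i (pderiv i r)) (pderiv i (pderiv i r)) =
      ∑ α ∈ r.support, ((α i : ℝ) * ((α i : ℝ) - 1)) * (mfactorial α * coeff α r ^ 2) := by
  rw [fischerInner_pderiv_left, fischerInner_pderiv_left]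
  exact fischerInner_diagonal (coeff_X_mul_X_mul_pderiv_pderiv i r)

/-! ### The mixed-energy inequality -/

omit [DecidableEq ι] in
/-- For `α` in the support of a polynomial homogeneous of degree `n`, `Σⱼ αⱼ = n`. [folklore] -/
theorem sum_eq_of_mem_support_of_isHomogeneous {r : MvPolynomial ι ℝ} {n : ℕ}
    (hr : r.IsHomogeneous n) {α : ι →₀ ℕ} (hα : α ∈ r.support) : ∑ j, α j = n := by
  have h := hr (mem_support_iff.1 hα)
  rw [Finsupp.weight_apply, Finsupp.sum_fintype α _ fun _ => rfl] at h
  simpa using h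

/-- If `1 ≤ αᵢ` and `αᵢ < Σⱼ αⱼ` then `α` has another non-zero coordinate: `α.erase i ≠ 0`. [folklore] -/
theorem erase_ne_zero_of_lt_sum {α : ι →₀ ℕ} {i : ι} (h : α i < ∑ j, α j) : α.erase i ≠ 0 := by
  intro h0
  have : ∑ j, α j = α i := by
    rw [← Finset.add_sum_erase Finset.univ _ (Finset.mem_univ i)]
    have hrest : ∑ j ∈ Finset.univ.erase i, α j = 0 := by
      refine Finset.sum_eq_zero fun j hj => ?_
      have := congrArg (fun f : ι →₀ ℕ => f j) h0
      simpa [Finsupp.erase_ne (Finset.ne_of_mem_erase hj)] using this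
    rw [hrest, add_zero]
  omega

/-- **The mixed-energy inequality.** For `r` homogeneous of degree `n` and a variable `i`,
`4 ((n - 1) ‖∂ᵢ r‖²_F - ‖∂ᵢ² r‖²_F) ≤ n² · Σ_{α : 1 ≤ αᵢ, α.erase i ≠ 0} α! r_α²`:
the left side is `4 Σ_α αᵢ (n - αᵢ) α! r_α²`, and `4 a (n - a) ≤ n²` vanishes unless
`1 ≤ a ≤ n - 1`, in which case the mode `α` is "mixed". (Spectral form:
`1_{[1,n-1]}(Nᵢ) ≥ (4/n²) Nᵢ (n - Nᵢ)` on degree-`n` polynomials.) [folklore] -/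
theorem four_mul_sub_le_sq_mul_mixedSum {r : MvPolynomial ι ℝ} {n : ℕ} (hr : r.IsHomogeneous n)
    (i : ι) :
    4 * (((n : ℝ) - 1) * fischerInner (pderiv i r) (pderiv i r) -
        fischerInner (pderiv i (pderiv i r)) (pderiv i (pderiv i r))) ≤
      (n : ℝ) ^ 2 * ∑ α ∈ r.support,
        (if 1 ≤ α i ∧ α.erase i ≠ 0 then mfactorial α * coeff α r ^ 2 else 0) := by
  rw [fischerInner_pderiv_self_eq_sum, fischerInner_pderiv_pderiv_self_eq_sum, Finset.mul_sum,
    ← Finset.sum_sub_distrib, Finset.mul_sum, Finset.mul_sum]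
  refine Finset.sum_le_sum fun α hα => ?_
  have hsum := sum_eq_of_mem_support_of_isHomogeneous hr hα
  have hw : 0 ≤ mfactorial α * coeff α r ^ 2 := mul_nonneg (mfactorial_pos α).le (sq_nonneg _)
  set w := mfactorial α * coeff α r ^ 2 with hwdef
  set a : ℕ := α i with ha
  -- the left summand is `4 a (n - a) w`
  have hleft : 4 * (((n : ℝ) - 1) * ((a : ℝ) * w) - (a : ℝ) * ((a : ℝ) - 1) * w) =
      4 * ((a : ℝ) * ((n : ℝ) - a)) * w := by ring
  rw [hleft]
  have hale : a ≤ n := by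
    rw [← hsum, ha]
    exact Finset.single_le_sum (fun j _ => Nat.zero_le (α j)) (Finset.mem_univ i)
  by_cases hmix : 1 ≤ α i ∧ α.erase i ≠ 0
  · rw [if_pos hmix]
    have hamgm : 4 * ((a : ℝ) * ((n : ℝ) - a)) ≤ (n : ℝ) ^ 2 := by
      nlinarith [sq_nonneg ((n : ℝ) - 2 * a)]
    exact mul_le_mul_of_nonneg_right hamgm hw
  · rw [if_neg hmix, mul_zero]
    -- then `a = 0` or `a = n`, so `a (n - a) = 0`
    have hzero : (a : ℝ) * ((n : ℝ) - a) = 0 := by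
      rcases Nat.eq_zero_or_pos a with h0 | hpos
      · rw [h0, Nat.cast_zero, zero_mul]
      · have hne : ¬ α.erase i ≠ 0 := fun h => hmix ⟨by rw [← ha]; exact hpos, h⟩
        push Not at hne
        have han : a = n := by
          by_contra hlt
          have hlt' : α i < ∑ j, α j := by rw [hsum]; omega
          exact erase_ne_zero_of_lt_sum hlt' hne
        rw [han, sub_self, mul_zero]
    rw [hzero, mul_zero, zero_mul]

end

end Literature.Algebra.Polynomial
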